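import Mathlib
import HarnessLib
import Summits.Langlands.Langlands.Theses.NonParallelVoid
import Literature.NumberTheory.Automorphic.ResGLnCohomology
import Literature.NumberTheory.Automorphic.ScholzeTorsionGalois
import Literature.FieldTheory.AlgClosed.PadicAlgClEquivComplex

/-!
# Line `eiscoh` for crux stmt-Langlands-17002
`Summit.Langlands.Langlands.Theses.NonParallelVoid.LocallyReducibleParallel` (strategist, second alt line)

Route `route-Langlands-NonParallelVoid`; crux = the nearly ordinary sector (see `Lines/birth.lean`,
`Lines/potaut.lean` for the statement in words).

## The line: potentially COHOMOLOGICAL of its own weight + Harder's Eisenstein dichotomy in an impure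
## weight + Brauer–Nesbitt — the seam of a CM Skinner–Wiles / Λ-adic Berger–Klosin theorem

`birth` and `potaut` close through Clozel purity of a CUSPIDAL `Π`.  But the engine with teeth for the
open core of this crux — an `R^{n.o.}_𝔪 = 𝕋_𝔪` theorem at an EISENSTEIN maximal ideal of Hida's nearly
ordinary Hecke algebra of `GL₂/F` (Berger–Klosin's ideal-of-reducibility method, made `Λ`-adic) — does
not output a cuspidal `Π`: it outputs "the Hecke eigensystem of `ρ` OCCURS in `H^•(S_{K_f}, E_λ)_𝔪 ⊗ ℚ̄_p`",
the Betti cohomology of the Bianchi (or `Res_{F'/ℚ} GL₂`) locally symmetric space with the algebraic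
coefficient system `E_λ` OF THE WEIGHT `λ(ρ)` READ OFF THE HODGE–TATE GAPS — a class that may a priori be
Eisenstein.  This line is cut along THAT seam, using the tree's receptacle
`ResGLnCohomology.levelCohomology (PadicAlgCl p) 2 F' 𝔫 λ q` (weights `λ : (F' →+* ℚ̄_p) → Fin 2 → ℤ`
indexed by `p`-ADIC embeddings — exactly the index set of the crux's labels), its Hecke operators
`heckeT`, and Scholze's normalisation `scholzeHeckePolynomial` of the Hecke–Frobenius identity:

* `stub_potCoh_bigImage` / `stub_potCoh_residuallyDegenerate` — `ρ` as in the crux, with `ρ̄|Γ_{F(ζ_p)}`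
  absolutely irreducible (resp. NOT) ⇒ for some finite `F'/F` over which `ρ` stays irreducible, some
  level `𝔫 ≠ 0`, weight `λ`, degree `q`: a non-zero simultaneous `T_{w,j}`-eigenclass
  `x ∈ H^q(S_{K_f(𝔫)}, E_λ(ℚ̄_p))` whose eigenvalues satisfy Scholze's identity
  `det(1 − X·ρ(Frob_w^{geom})) = P_w(X)` at cofinitely many `w`, embeddings of `F` extend to `F'`, and the
  GAP DICTIONARY `gap_τ(ρ) = u·(λ_{e',0} − λ_{e',1}) + d` (`u = ±1`, one `(u,d)`) for every label `(v,τ)` of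
  `F` and every `e' : F' → ℚ̄_p` over it.  Big image: known in print modulo assembly (potential ordinary
  automorphy as in `potaut` + Eichler–Shimura–Harder realisation `ResGLnCohomology.cuspidalEigenclass_exists`
  + coefficient transport along `ι`); residually degenerate: THE OPEN CORE, in the form the Eisenstein-prime
  engines produce it.
* `stub_harderEisenstein` — (Harder 1987 + Borel–Wallach/Clozel purity of cuspidal cohomology + Weil's
  `p`-adic avatars; known in print, XL) over ANY number field `K`: a non-zero simultaneous eigenclass in
  `H^q(S_{K_f(𝔫)}, E_λ(ℚ̄_p))`, `𝔫 ≠ 0`, whose weight is IMPURE for some `ι : ℚ̄_p ≃ ℂ`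
  (no `w₀ ∈ ℤ` with `λ_{e,0} + λ_{ē,1} = w₀` for all `e`, `ē = ι⁻¹∘conj∘ι∘e`) has EISENSTEIN eigenvalues:
  `P_w(X) = (1 − χ₁(Frob_w^{geom})X)(1 − χ₂(Frob_w^{geom})X)` cofinitely, for two continuous characters
  `χ₁, χ₂ : Γ_K → ℚ̄_pˣ`.
* `stub_notSumOfCharacters` — (Chebotarev + continuity + Brauer–Nesbitt; size L) an IRREDUCIBLE
  continuous `r : Γ_K → GL₂(ℚ̄_p)` cannot have `det(1 − X·r(Frob^{geom})) = (1 − χ₁ X)(1 − χ₂ X)` at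
  cofinitely many places.

Composition `LocallyReducibleParallel_of` (kernel-checked, no `sorry`): suppose the gaps are not all
equal; pick labels `ℓ₁, ℓ₂` with `g₁ ≠ g₂` (pure logic from the negated conclusion); realise `ρ`
potentially-cohomologically (stubs 1–2); the gap dictionary and `Hom(F, ℚ̄_p) = {e, e^c}`
(`embedding_eq_or_eq_conj`, proved) give an upstairs embedding `e'` with
`λ`-gap(`e'`) ≠ `λ`-gap(`ē'`), which contradicts purity for THAT `ι` (purity forces equal `λ`-gaps at
`e'` and `ē'`); so stub 3 makes the eigensystem Eisenstein and stub 4 contradicts the irreducibility of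
`ρ|Γ_{F'}`.  No automorphic representation, no infinity type, no Hodge–Tate/Harish-Chandra dictionary
appears: weights are Betti coefficient weights.

Disproof used: none exists for this crux (2026-08-17).  Negatives index: nothing related.
-/

set_option linter.dupNamespace false

noncomputable section

namespace Summit.Langlands.Langlands.Cruxes.LocallyReducibleParallel.Eiscoh

open Summit.Langlands.Langlands.Theses.NonParallelVoid
open Literature.NumberTheory.GaloisRepresentations Literature.NumberTheory.Automorphic
open Filter Polynomial

/-! ## 1. The four stubs -/

/-- **STUB 1 — potentially cohomological of its own weight, big residual image (known in print modulo
assembly; XL).**  `F` imaginary quadratic, `p` any prime, `ρ` as in the crux (irreducible, a.e.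
unramified, de Rham with two distinct labelled weights at every label, invariant complete flag at every
`v ∣ p`), `ρ̄|Γ_{F(ζ_p)}` absolutely irreducible ⇒ there are a finite extension `F'/F` with `ρ|Γ_{F'}`
irreducible, a level `𝔫 ≠ 0`, a DOMINANT weight `λ : (F' →+* ℚ̄_p) → Fin 2 → ℤ` (`λ_{e,1} ≤ λ_{e,0}`;
non-dominant weights are junk-collapsed by the tree's `polyShift`/`toNat`), a degree `q`, a NON-ZERO class
`x ∈ H^q(S_{K_f(𝔫)}, E_λ(ℚ̄_p))` (`ResGLnCohomology.levelCohomology`) and eigenvalues `a w j` with: at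
cofinitely many `w`, `T_{w,j} x = a w j • x` (`j = 1, 2`, `ResGLnCohomology.heckeT`) and Scholze's
identity `det(1 − X·ρ(σ⁻¹)) = scholzeHeckePolynomial 2 q_w (a w)` for every arithmetic Frobenius `σ` at
every `𝔓 ∣ w`; every `e : F → ℚ̄_p` extends to `F'`; and ONE pair `(d, u)`, `u = ±1`, with
`y − x = u·(λ_{e',0} − λ_{e',1}) + d` whenever `HT_τ(ρ|F_v) = {x < y}` and `e'` lies over `τ|_F`.  Paper
proof: potential ordinary automorphy (Taylor/Moret-Bailly + ACC+ Thm. 6.1.2 / Miagkov–Thorne, with the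
Bloch–Kato re-flagging at split `p` and `F' ⊇ F·E` at non-split `p`, same-sign flags) gives a cuspidal
cohomological `Π` on `GL₂/F'` of the weight dictated by the HT gaps; Eichler–Shimura–Harder / Franke
(`ResGLnCohomology.cuspidalEigenclass_exists`) realises it in `H^•(S, E_λ(ℂ))`; transport along `ι`
(`ResGLnCohomology.exists_coeffSemimap_ringEquiv`); Scholze's normalisation is that of `r_ι(Π)` up to an
integral Tate twist, absorbed in `λ ↦ λ + (m,m)` and in `d`.  Open corner: MIXED-sign nearly ordinary
`ρ` at a non-split `p` (ordinary in no flag).  Why it might fail as typed: only with Fontaine–Mazur.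
[cite: ACCGHLNSTT2023, Thm. 6.1.2 and Rem. 6.1.3] [cite: Scholze2015, §V.4 (P_w) and Cor. V.4.2]
[cite: Harder1987, Invent. Math. 89 (Eisenstein cohomology of GL₂)] [cite: Clozel1990, Lemme 3.15] -/
theorem stub_potCoh_bigImage : ∀ (F : Type) [Field F] [NumberField F] [Algebra.IsQuadraticExtension ℚ F], NumberField.IsTotallyComplex F → ∀ (p : ℕ) [Fact p.Prime] (ρ : Literature.NumberTheory.GaloisRepresentations.FramedGaloisRep F (PadicAlgCl p) 2), ρ.toGaloisRep.IsIrreducible → (∀ᶠ v : IsDedekindDomain.HeightOneSpectrum (NumberField.RingOfIntegers F) in Filter.cofinite, ρ.IsUnramifiedAt v) → (∀ (v : IsDedekindDomain.HeightOneSpectrum (NumberField.RingOfIntegers F)) (hv : ((p : ℕ) : NumberField.RingOfIntegers F) ∈ v.asIdeal), (Literature.NumberTheory.PAdicHodge.fontainePstAdicCompletion v p hv).IsDeRhamFramed (ρ.toLocal v) ∧ (letI := (Literature.NumberTheory.PAdicHodge.fontainePstAdicCompletion v p hv).algebra; ∀ τ : v.adicCompletion F →ₐ[ℚ_[p]] PadicAlgCl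 p, ∃ a b : ℤ, a < b ∧ ρ.labelledHodgeTateWeightsAt v (Literature.NumberTheory.PAdicHodge.fontainePstAdicCompletion v p hv).algebra (Literature.NumberTheory.PAdicHodge.fontainePstAdicCompletion v p hv).𝔅 τ.toRingHom = {a, b})) → (∀ v : IsDedekindDomain.HeightOneSpectrum (NumberField.RingOfIntegers F), ((p : ℕ) : NumberField.RingOfIntegers F) ∈ v.asIdeal → Literature.NumberTheory.GaloisRepresentations.FramedRep.HasInvariantCompleteFlag (ρ.toLocal v)) → Literature.NumberTheory.GaloisRepresentations.FramedGaloisRep.IsResiduallyAbsIrreducible (ρ.restrictField (CyclotomicField p F)) → ∃ (F' : Type) (_ : Field F') (_ : NumberField F') (_ : Algebra F F') (𝔫 : Ideal (NumberField.RingOfIntegers F')) (lam : (F' →+* PadicAlgCl p) → Fin 2 → ℤ) (q : ℕ) (x : Literature.NumberTheory.Automorphic.ResGLnCohomology.levelCohomology (PadicAlgCl p) 2 F' 𝔫 lam q) (a : IsDedekindDomain.HeightOneSpectrum (NumberField.RingOfIntegers F') → ℕ → PadicAlgCl p), 𝔫 ≠ 0 ∧ (∀ e' : F' →+* PadicAlgCl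 p, lam e' 1 ≤ lam e' 0) ∧ (ρ.restrictField F').toGaloisRep.IsIrreducible ∧ x ≠ 0 ∧ (∀ᶠ w : IsDedekindDomain.HeightOneSpectrum (NumberField.RingOfIntegers F') in Filter.cofinite, (∀ j : ℕ, 1 ≤ j → j ≤ 2 → Literature.NumberTheory.Automorphic.ResGLnCohomology.heckeT (PadicAlgCl p) 2 F' 𝔫 lam q w j x = a w j • x) ∧ ∀ 𝔓 ∈ w.primesAbove, ∀ σ : Field.absoluteGaloisGroup F', IsArithFrobAt (NumberField.RingOfIntegers F') σ 𝔓 → (((ρ.restrictField F') σ⁻¹ : GL (Fin 2) (PadicAlgCl p)) : Matrix (Fin 2) (Fin 2) (PadicAlgCl p)).charpolyRev = Literature.NumberTheory.Automorphic.scholzeHeckePolynomial 2 w.residueCard (a w)) ∧ (∀ e : F →+* PadicAlgCl p, ∃ e' : F' →+* PadicAlgCl p, e'.comp (algebraMap F F') = e) ∧ ∃ (d u : ℤ), (u = 1 ∨ u = -1) ∧ ∀ (v : IsDedekindDomain.HeightOneSpectrum (NumberField.RingOfIntegers F)) (hv : ((p : ℕ) : NumberField.RingOfIntegers F) ∈ v.asIdeal),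 letI := (Literature.NumberTheory.PAdicHodge.fontainePstAdicCompletion v p hv).algebra; ∀ (τ : v.adicCompletion F →ₐ[ℚ_[p]] PadicAlgCl p) (e' : F' →+* PadicAlgCl p), e'.comp (algebraMap F F') = τ.toRingHom.comp (algebraMap F (v.adicCompletion F)) → ∀ x' y' : ℤ, ρ.labelledHodgeTateWeightsAt v (Literature.NumberTheory.PAdicHodge.fontainePstAdicCompletion v p hv).algebra (Literature.NumberTheory.PAdicHodge.fontainePstAdicCompletion v p hv).𝔅 τ.toRingHom = {x', y'} → x' < y' → y' - x' = u * (lam e' 0 - lam e' 1) + d := by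
  sorry

/-- **STUB 2 — potentially cohomological of its own weight, residually degenerate image: THE OPEN
CORE (open problem), in the shape an Eisenstein-prime engine outputs it.**  As stub 1 but with
`ρ̄|Γ_{F(ζ_p)}` NOT absolutely irreducible (residually reducible `ρ̄^{ss} = χ̄₁ ⊕ χ̄₂`, or residually
induced from the quadratic subfield of `F(ζ_p)`).  The conclusion allows the eigenclass to be of ANY
Hecke type (Eisenstein included) and to live over any finite `F'` keeping `ρ` irreducible: it is exactly
"the eigensystem of `ρ` occurs in `H^•(S_{K_f}, E_{λ(ρ)})_𝔪 ⊗ ℚ̄_p`", i.e. the output of an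
`R^{n.o.}_𝔪 = 𝕋_𝔪` theorem at the Eisenstein maximal ideal `𝔪 = 𝔪_{χ̄₁,χ̄₂}` of Hida's nearly
ordinary Hecke algebra of `GL₂/F` followed by Hida's control theorem at the arithmetic weight `λ(ρ)`.
Engines: Berger–Klosin (ideal of reducibility `I^{red}`, `#R/I^{red}` bounded by an `L`-value through the
Iwasawa main conjecture for `F` (Rubin), `#𝕋/J^{Eis}` bounded below by Berger's Eisenstein congruences,
commutative-algebra criterion ⇒ `R = 𝕋`) — printed in parallel weight 2, `p` split, unique residual
extension; the needed form is `Λ`-adic over the two-variable weight space (two-variable Katz `p`-adic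
`L`-function); Skinner–Wiles' own method needs a totally real base.  CM `ρ = Ind χ`: automorphic
induction (known).  Why it might fail as typed: only with Fontaine–Mazur; the honest risk is that it
stays open.
[cite: BergerKlosin2011, Thm. 1.1] [cite: Berger2009, Thm. 1.1] [cite: SkinnerWiles1999, §4]
[cite: CalegariMazur2008, Conj. 1.3 and §2.4] [cite: Hida1993, control theorem for the p-ordinary cohomology of SL(2) over number fields (Duke 69)] -/
theorem stub_potCoh_residuallyDegenerate : ∀ (F : Type) [Field F] [NumberField F] [Algebra.IsQuadraticExtension ℚ F], NumberField.IsTotallyComplex F → ∀ (p : ℕ) [Fact p.Prime] (ρ : Literature.NumberTheory.GaloisRepresentations.FramedGaloisRep F (PadicAlgCl p) 2), ρ.toGaloisRep.IsIrreducible → (∀ᶠ v : IsDedekindDomain.HeightOneSpectrum (NumberField.RingOfIntegers F) in Filter.cofinite, ρ.IsUnramifiedAt v) → (∀ (v : IsDedekindDomain.HeightOneSpectrum (NumberField.RingOfIntegers F)) (hv : ((p : ℕ) : NumberField.RingOfIntegers F) ∈ v.asIdeal), (Literature.NumberTheory.PAdicHodge.fontainePstAdicCompletion v p hv).IsDeRhamFramed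 (ρ.toLocal v) ∧ (letI := (Literature.NumberTheory.PAdicHodge.fontainePstAdicCompletion v p hv).algebra; ∀ τ : v.adicCompletion F →ₐ[ℚ_[p]] PadicAlgCl p, ∃ a b : ℤ, a < b ∧ ρ.labelledHodgeTateWeightsAt v (Literature.NumberTheory.PAdicHodge.fontainePstAdicCompletion v p hv).algebra (Literature.NumberTheory.PAdicHodge.fontainePstAdicCompletion v p hv).𝔅 τ.toRingHom = {a, b})) → (∀ v : IsDedekindDomain.HeightOneSpectrum (NumberField.RingOfIntegers F), ((p : ℕ) : NumberField.RingOfIntegers F) ∈ v.asIdeal → Literature.NumberTheory.GaloisRepresentations.FramedRep.HasInvariantCompleteFlag (ρ.toLocal v)) → ¬ Literature.NumberTheory.GaloisRepresentations.FramedGaloisRep.IsResiduallyAbsIrreducible (ρ.restrictField (CyclotomicField p F)) → ∃ (F' : Type) (_ : Field F') (_ : NumberField F') (_ : Algebra F F') (𝔫 : Ideal (NumberField.RingOfIntegers F')) (lam : (F' →+* PadicAlgCl p) → Fin 2 → ℤ) (q : ℕ) (x : Literature.NumberTheory.Automorphic.ResGLnCohomology.levelCohomology (PadicAlgCl p) 2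 F' 𝔫 lam q) (a : IsDedekindDomain.HeightOneSpectrum (NumberField.RingOfIntegers F') → ℕ → PadicAlgCl p), 𝔫 ≠ 0 ∧ (∀ e' : F' →+* PadicAlgCl p, lam e' 1 ≤ lam e' 0) ∧ (ρ.restrictField F').toGaloisRep.IsIrreducible ∧ x ≠ 0 ∧ (∀ᶠ w : IsDedekindDomain.HeightOneSpectrum (NumberField.RingOfIntegers F') in Filter.cofinite, (∀ j : ℕ, 1 ≤ j → j ≤ 2 → Literature.NumberTheory.Automorphic.ResGLnCohomology.heckeT (PadicAlgCl p) 2 F' 𝔫 lam q w j x = a w j • x) ∧ ∀ 𝔓 ∈ w.primesAbove, ∀ σ : Field.absoluteGaloisGroup F', IsArithFrobAt (NumberField.RingOfIntegers F') σ 𝔓 → (((ρ.restrictField F') σ⁻¹ : GL (Fin 2) (PadicAlgCl p)) : Matrix (Fin 2) (Fin 2) (PadicAlgCl p)).charpolyRev = Literature.NumberTheory.Automorphic.scholzeHeckePolynomial 2 w.residueCard (a w)) ∧ (∀ e : F →+* PadicAlgCl p, ∃ e' : F' →+* PadicAlgCl p, e'.comp (algebraMap F F') = e) ∧ ∃ (d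 u : ℤ), (u = 1 ∨ u = -1) ∧ ∀ (v : IsDedekindDomain.HeightOneSpectrum (NumberField.RingOfIntegers F)) (hv : ((p : ℕ) : NumberField.RingOfIntegers F) ∈ v.asIdeal), letI := (Literature.NumberTheory.PAdicHodge.fontainePstAdicCompletion v p hv).algebra; ∀ (τ : v.adicCompletion F →ₐ[ℚ_[p]] PadicAlgCl p) (e' : F' →+* PadicAlgCl p), e'.comp (algebraMap F F') = τ.toRingHom.comp (algebraMap F (v.adicCompletion F)) → ∀ x' y' : ℤ, ρ.labelledHodgeTateWeightsAt v (Literature.NumberTheory.PAdicHodge.fontainePstAdicCompletion v p hv).algebra (Literature.NumberTheory.PAdicHodge.fontainePstAdicCompletion v p hv).𝔅 τ.toRingHom = {x', y'} → x' < y' → y' - x' = u * (lam e' 0 - lam e' 1) + d := by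
  sorry

/-- **STUB 3 — Harder's Eisenstein dichotomy in an impure weight (known in print; XL).**  For ANY number
field `K`, prime `p`, level `𝔫 ≠ 0`, DOMINANT weight `λ : (K →+* ℚ̄_p) → Fin 2 → ℤ` (`λ_{e,1} ≤ λ_{e,0}` at
every `e`: the tree's `GLnCohomology.CoeffModule` reads `λ` through `(λ_0 − λ_1).toNat`, so only dominant `λ`
name their coefficient system faithfully — without this the stub would be false on junk weights), degree `q`,
a NON-ZERO class
`x ∈ H^q(S_{K_f(𝔫)}, E_λ(ℚ̄_p))` which is a simultaneous `T_{w,j}`-eigenclass (`j = 1,2`) with eigenvalues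
`a w j` at cofinitely many `w`, and `ι : ℚ̄_p ≃ ℂ` for which `λ` is IMPURE — there is no `w₀ ∈ ℤ` with
`λ_{e,0} + λ_{ē,1} = w₀` for every `e : K → ℚ̄_p`, `ē = ι⁻¹∘conj∘ι∘e` (the conjugate-self-duality
`λ_{ē} = w₀ − rev(λ_e)` of weights of cohomological cuspidal representations) — the eigensystem is
EISENSTEIN: there are continuous characters `χ₁, χ₂ : Γ_K → ℚ̄_pˣ` with
`scholzeHeckePolynomial 2 q_w (a w) = (1 − χ₁(σ⁻¹)X)(1 − χ₂(σ⁻¹)X)` for every arithmetic Frobenius `σ`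
at every `𝔓 ∣ w`, cofinitely in `w`.  Paper proof: `H^•(S_{K_f}, E_λ(ℂ)) = H^•_{cusp} ⊕ H^•_{Eis}`
(Franke; for `GL₂` Harder 1987); cuspidal cohomology with coefficients `E_λ` vanishes unless `λ` is pure
(Borel–Wallach / Clozel's purity lemma: `Π_∞` cohomological for `E_λ` forces `E_λ^∨ ≅ E_λ^c ⊗ det^{w₀}`);
the Eisenstein eigensystems of `GL₂` are those of pairs `(φ₁, φ₂)` of algebraic Hecke characters of `K`
(Harder, Thm. 2: boundary of the Borel–Serre compactification = torus bundles, Levi `GL₁ × GL₁`); Weil's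
`p`-adic avatars `χ_i` of `φ_i|·|^{m_i}` satisfy Scholze's `q_w^{j(j+1)/2}`-normalised identity with
INTEGRAL twists (for `GL₂/ℚ`, weight `k` Eisenstein series: `P_ℓ = (1 − ℓX)(1 − ℓ^kX)`); transport
`ℚ̄_p ↔ ℂ` along `ι`.  Why it might fail as typed: the tree's receptacle is group cohomology of
`GL₂(K)⁺` on `Fun(GL₂(𝔸_K^∞)/K_f(𝔫), E_λ)`, equal to `H^•(S_{K_f(𝔫)}, Ẽ_λ)` in characteristic `0`
(finite isotropy); `𝔫 ≠ 0` excludes the degenerate level.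
[cite: Harder1987, main theorems on H_Eis for GL₂ over number fields (Invent. Math. 89)] [cite: Franke1998, Thm. 18]
[cite: BorelWallach2000, II §6.12 and VII] [cite: Scholze2015, §V.4 (P_w) and Thm. V.4.1]
[cite: Clozel1990, Lemme 4.9] -/
theorem stub_harderEisenstein : ∀ (K : Type) [Field K] [NumberField K] (p : ℕ) [Fact p.Prime] (𝔫 : Ideal (NumberField.RingOfIntegers K)) (lam : (K →+* PadicAlgCl p) → Fin 2 → ℤ) (q : ℕ) (x : Literature.NumberTheory.Automorphic.ResGLnCohomology.levelCohomology (PadicAlgCl p) 2 K 𝔫 lam q) (a : IsDedekindDomain.HeightOneSpectrum (NumberField.RingOfIntegers K) → ℕ → PadicAlgCl p), 𝔫 ≠ 0 → (∀ e : K →+* PadicAlgCl p, lam e 1 ≤ lam e 0) → x ≠ 0 → (∀ᶠ w : IsDedekindDomain.HeightOneSpectrum (NumberField.RingOfIntegers K) in Filter.cofinite, ∀ j : ℕ, 1 ≤ j → j ≤ 2 → Literature.NumberTheory.Automorphic.ResGLnCohomology.heckeT (PadicAlgCl p) 2 K 𝔫 lam q w j x = a w j • x) → ∀ (ι : PadicAlgCl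 p ≃+* ℂ), (¬ ∃ w₀ : ℤ, ∀ e : K →+* PadicAlgCl p, lam e 0 + lam (ι.symm.toRingHom.comp ((starRingEnd ℂ).comp (ι.toRingHom.comp e))) 1 = w₀) → ∃ χ₁ χ₂ : ContinuousMonoidHom (Field.absoluteGaloisGroup K) (PadicAlgCl p)ˣ, ∀ᶠ w : IsDedekindDomain.HeightOneSpectrum (NumberField.RingOfIntegers K) in Filter.cofinite, ∀ 𝔓 ∈ w.primesAbove, ∀ σ : Field.absoluteGaloisGroup K, IsArithFrobAt (NumberField.RingOfIntegers K) σ 𝔓 → Literature.NumberTheory.Automorphic.scholzeHeckePolynomial 2 w.residueCard (a w) = (1 - Polynomial.C ((χ₁ σ⁻¹ : (PadicAlgCl p)ˣ) : PadicAlgCl p) * Polynomial.X) * (1 - Polynomial.C ((χ₂ σ⁻¹ : (PadicAlgCl p)ˣ) : PadicAlgCl p) * Polynomial.X) := by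
  sorry

/-- **STUB 4 — an irreducible two-dimensional `p`-adic representation is not Frobenius-wise a sum of two
characters (Chebotarev + continuity + Brauer–Nesbitt; size L).**  For a number field `K`, a continuous
IRREDUCIBLE `r : Γ_K → GL₂(ℚ̄_p)` and continuous characters `χ₁, χ₂ : Γ_K → ℚ̄_pˣ`: it is impossible
that at cofinitely many places `w`, for every prime `𝔓 ∣ w` of `ℤ̄_K` and every arithmetic Frobenius
`σ` at `𝔓`, `det(1 − X·r(σ⁻¹)) = (1 − χ₁(σ⁻¹)X)(1 − χ₂(σ⁻¹)X)`.  Paper proof: Frobenius elements at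
cofinitely many places are dense in `Γ_K` (Chebotarev, through the finite quotients); by continuity
`tr r = χ₁ + χ₂` and `det r = χ₁χ₂` on `Γ_K`; Brauer–Nesbitt in characteristic `0` gives
`r^{ss} ≅ χ₁ ⊕ χ₂`, contradicting irreducibility.  No unramifiedness hypothesis is needed (the identity
is assumed for EVERY Frobenius lift).  Why it might fail as typed: vacuity is excluded — every finite
place has a prime of `ℤ̄_K` above it (`primesAbove_nonempty`) and an arithmetic Frobenius there.
[cite: SerreAbelianLadic1968, Ch. I §2.3 (Chebotarev density and characters determine semisimplification)]
[cite: CurtisReiner1962, (30.16) (Brauer–Nesbitt)] -/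
theorem stub_notSumOfCharacters : ∀ (K : Type) [Field K] [NumberField K] (p : ℕ) [Fact p.Prime] (r : Literature.NumberTheory.GaloisRepresentations.FramedGaloisRep K (PadicAlgCl p) 2), r.toGaloisRep.IsIrreducible → ∀ (χ₁ χ₂ : ContinuousMonoidHom (Field.absoluteGaloisGroup K) (PadicAlgCl p)ˣ), (∀ᶠ w : IsDedekindDomain.HeightOneSpectrum (NumberField.RingOfIntegers K) in Filter.cofinite, ∀ 𝔓 ∈ w.primesAbove, ∀ σ : Field.absoluteGaloisGroup K, IsArithFrobAt (NumberField.RingOfIntegers K) σ 𝔓 → ((r σ⁻¹ : GL (Fin 2) (PadicAlgCl p)) : Matrix (Fin 2) (Fin 2) (PadicAlgCl p)).charpolyRev = (1 - Polynomial.C ((χ₁ σ⁻¹ : (PadicAlgCl p)ˣ) : PadicAlgCl p) * Polynomial.X) * (1 - Polynomial.C ((χ₂ σ⁻¹ : (PadicAlgCl p)ˣ) : PadicAlgCl p) * Polynomial.X)) → False := by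
  sorry

/-! ## 2. The stub statements as named propositions -/

namespace _Goal

/-- The statement of `stub_potCoh_bigImage` (literally its type). [folklore] -/
def stub_potCoh_bigImage : Prop :=
  type_of% @Summit.Langlands.Langlands.Cruxes.LocallyReducibleParallel.Eiscoh.stub_potCoh_bigImage

/-- The statement of `stub_potCoh_residuallyDegenerate` (literally its type). [folklore] -/
def stub_potCoh_residuallyDegenerate : Prop :=
  type_of% @Summit.Langlands.Langlands.Cruxes.LocallyReducibleParallel.Eiscoh.stub_potCoh_residuallyDegenerate

/-- The statement of `stub_harderEisenstein` (literally its type). [folklore] -/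
def stub_harderEisenstein : Prop :=
  type_of% @Summit.Langlands.Langlands.Cruxes.LocallyReducibleParallel.Eiscoh.stub_harderEisenstein

/-- The statement of `stub_notSumOfCharacters` (literally its type). [folklore] -/
def stub_notSumOfCharacters : Prop :=
  type_of% @Summit.Langlands.Langlands.Cruxes.LocallyReducibleParallel.Eiscoh.stub_notSumOfCharacters

end _Goal

/-! ## 3. Sorry-free helpers -/

/-- **The two `p`-adic embeddings of an imaginary quadratic field are swapped by any complex conjugation
transported along `ι : ℚ̄_p ≃ ℂ`** (same lemma as in `Lines/potaut.lean`, re-proved to keep the lines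
import-independent). [folklore] -/
theorem embedding_eq_or_eq_conj (F : Type) [Field F] [NumberField F]
    [Algebra.IsQuadraticExtension ℚ F] (hF : NumberField.IsTotallyComplex F) (p : ℕ) [Fact p.Prime]
    (ι : PadicAlgCl p ≃+* ℂ) (e τ : F →+* PadicAlgCl p) :
    τ = e ∨ τ = ι.symm.toRingHom.comp ((starRingEnd ℂ).comp (ι.toRingHom.comp e)) := by
  classical
  set e' : F →+* PadicAlgCl p := ι.symm.toRingHom.comp ((starRingEnd ℂ).comp (ι.toRingHom.comp e))
    with he'
  have hne : e ≠ e' := by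
    intro h
    have hreal : NumberField.ComplexEmbedding.IsReal (ι.toRingHom.comp e) := by
      rw [NumberField.ComplexEmbedding.isReal_iff]
      ext x
      have hx := congrArg (fun f : F →+* PadicAlgCl p => ι (f x)) h
      simp only [he', RingHom.coe_comp, Function.comp_apply, RingEquiv.toRingHom_eq_coe,
        RingEquiv.coe_toRingHom, RingEquiv.apply_symm_apply] at hx
      rw [NumberField.ComplexEmbedding.conjugate_coe_eq]
      simp only [RingHom.coe_comp, Function.comp_apply, RingEquiv.toRingHom_eq_coe,
        RingEquiv.coe_toRingHom]
      exact hx.symm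
    haveI := hF
    exact NumberField.IsTotallyComplex.complexEmbedding_not_isReal _ hreal
  have hcard : Fintype.card (F →+* PadicAlgCl p) = 2 := by
    rw [NumberField.Embeddings.card F (PadicAlgCl p), Algebra.IsQuadraticExtension.finrank_eq_two ℚ F]
  have huniv : ({e, e'} : Finset (F →+* PadicAlgCl p)) = Finset.univ := by
    apply Finset.eq_univ_of_card
    rw [Finset.card_pair hne, hcard]
  have hmem : τ ∈ ({e, e'} : Finset (F →+* PadicAlgCl p)) := by
    rw [huniv]; exact Finset.mem_univ τ
  simpa only [Finset.mem_insert, Finset.mem_singleton] using hmem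

/-- Transported complex conjugation on `p`-adic embeddings is an involution:
`(ι⁻¹∘conj∘ι) ∘ (ι⁻¹∘conj∘ι) ∘ e = e`. [folklore] -/
theorem conj_conj_embedding {K : Type} [Field K] (p : ℕ) [Fact p.Prime] (ι : PadicAlgCl p ≃+* ℂ)
    (e : K →+* PadicAlgCl p) :
    ι.symm.toRingHom.comp ((starRingEnd ℂ).comp (ι.toRingHom.comp
      (ι.symm.toRingHom.comp ((starRingEnd ℂ).comp (ι.toRingHom.comp e))))) = e := by
  ext z
  simp

/-! ## 4. The composition (kernel-checked, no `sorry`) -/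

/-- **`LocallyReducibleParallel` from the four stubs.**  If the gaps were not all equal, two labels
`ℓ₁, ℓ₂` of `F` have gaps `g₁ ≠ g₂`; realise `ρ` potentially-cohomologically (stubs 1–2, by residual
regime) over `F'` with weight `λ`, eigenclass `x`, eigenvalues `a`, and the gap dictionary `(d, u)`;
with any `ι : ℚ̄_p ≃ ℂ` (`PadicAlgCl.nonempty_ringEquiv_complex`) the labels lie over `e` or `e^c`
(`embedding_eq_or_eq_conj`), whence an upstairs `e'` with `λ`-gap(`e'`) ≠ `λ`-gap(`ē'`); this is
impurity for `ι` (purity at `e'` and at `ē'`, `conj_conj_embedding`), so stub 3 makes the eigensystem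
Eisenstein at cofinitely many `w`, which together with Scholze's identity for `ρ|Γ_{F'}` feeds stub 4:
contradiction with the irreducibility of `ρ|Γ_{F'}`. [folklore] -/
theorem LocallyReducibleParallel_of (h₁ : _Goal.stub_potCoh_bigImage)
    (h₂ : _Goal.stub_potCoh_residuallyDegenerate) (h₃ : _Goal.stub_harderEisenstein)
    (h₄ : _Goal.stub_notSumOfCharacters) : LocallyReducibleParallel := by
  unfold _Goal.stub_potCoh_bigImage at h₁
  unfold _Goal.stub_potCoh_residuallyDegenerate at h₂
  unfold _Goal.stub_harderEisenstein at h₃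
  unfold _Goal.stub_notSumOfCharacters at h₄
  classical
  intro F _ _ _ hF p _ ρ hirr hunr hHT hflag
  by_contra hpar
  -- Step 1: realise `ρ` potentially-cohomologically, by residual regime
  have hPC := (show _ from
    if hbig : Literature.NumberTheory.GaloisRepresentations.FramedGaloisRep.IsResiduallyAbsIrreducible
        (ρ.restrictField (CyclotomicField p F))
    then h₁ F hF p ρ hirr hunr hHT hflag hbig
    else h₂ F hF p ρ hirr hunr hHT hflag hbig)
  obtain ⟨F', _instF, _instNF, _instAlg, 𝔫, lam, q, x, a, h𝔫, hdom, hirr', hx, hev, hext, d, u, hu,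
    hdict⟩ := hPC
  -- Step 2: two labels with different gaps
  push Not at hpar
  obtain ⟨v₁, hv₁, τ₁, -⟩ := hpar 0
  obtain ⟨x₁, y₁, hxy₁, hHT₁⟩ := (hHT v₁ hv₁).2 τ₁
  obtain ⟨v₂, hv₂, τ₂, hne₂⟩ := hpar (y₁ - x₁)
  obtain ⟨x₂, y₂, hxy₂, hHT₂⟩ := (hHT v₂ hv₂).2 τ₂
  have hgap : y₂ - x₂ ≠ y₁ - x₁ := by
    intro h
    have hy : y₂ = x₂ + (y₁ - x₁) := by omega
    exact hne₂ x₂ (by rw [hHT₂, hy])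
  -- Step 3: an isomorphism `ι : ℚ̄_p ≃ ℂ` and the embeddings under the two labels
  obtain ⟨ι⟩ := PadicAlgCl.nonempty_ringEquiv_complex p
  letI i₁ := (Literature.NumberTheory.PAdicHodge.fontainePstAdicCompletion v₁ p hv₁).algebra
  letI i₂ := (Literature.NumberTheory.PAdicHodge.fontainePstAdicCompletion v₂ p hv₂).algebra
  obtain ⟨e₁, he₁⟩ := hext (τ₁.toRingHom.comp (algebraMap F (v₁.adicCompletion F)))
  have hg₁ : y₁ - x₁ = u * (lam e₁ 0 - lam e₁ 1) + d := hdict v₁ hv₁ τ₁ e₁ he₁ x₁ y₁ hHT₁ hxy₁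
  -- Step 4: `λ`-gap(e₁) ≠ `λ`-gap(e₁^c) for the conjugate upstairs embedding
  have hlamgap : lam e₁ 0 - lam e₁ 1 ≠
      lam (ι.symm.toRingHom.comp ((starRingEnd ℂ).comp (ι.toRingHom.comp e₁))) 0 -
        lam (ι.symm.toRingHom.comp ((starRingEnd ℂ).comp (ι.toRingHom.comp e₁))) 1 := by
    rcases embedding_eq_or_eq_conj F hF p ι (τ₁.toRingHom.comp (algebraMap F (v₁.adicCompletion F)))
        (τ₂.toRingHom.comp (algebraMap F (v₂.adicCompletion F))) with h12 | h12
    · -- both labels over the same embedding of `F`: the dictionary at `e₁` gives equal gaps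
      exfalso
      have hg₂ : y₂ - x₂ = u * (lam e₁ 0 - lam e₁ 1) + d :=
        hdict v₂ hv₂ τ₂ e₁ (by rw [he₁, ← h12]) x₂ y₂ hHT₂ hxy₂
      exact hgap (hg₂.trans hg₁.symm)
    · -- the second label lies over the conjugate embedding: read the dictionary at `e₁^c`
      have hover : (ι.symm.toRingHom.comp ((starRingEnd ℂ).comp (ι.toRingHom.comp e₁))).comp
          (algebraMap F F') = τ₂.toRingHom.comp (algebraMap F (v₂.adicCompletion F)) := by
        rw [h12, ← he₁]
        simp only [RingHom.comp_assoc]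
      have hg₂ : y₂ - x₂ =
          u * (lam (ι.symm.toRingHom.comp ((starRingEnd ℂ).comp (ι.toRingHom.comp e₁))) 0 -
            lam (ι.symm.toRingHom.comp ((starRingEnd ℂ).comp (ι.toRingHom.comp e₁))) 1) + d :=
        hdict v₂ hv₂ τ₂ _ hover x₂ y₂ hHT₂ hxy₂
      intro h
      apply hgap
      rw [hg₂, hg₁, h]
  -- Step 5: impurity of `λ` for `ι`
  have himpure : ¬ ∃ w₀ : ℤ, ∀ e : F' →+* PadicAlgCl p,
      lam e 0 + lam (ι.symm.toRingHom.comp ((starRingEnd ℂ).comp (ι.toRingHom.comp e))) 1 = w₀ := by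
    rintro ⟨w₀, hw⟩
    have h1 := hw e₁
    have h2 := hw (ι.symm.toRingHom.comp ((starRingEnd ℂ).comp (ι.toRingHom.comp e₁)))
    rw [conj_conj_embedding] at h2
    apply hlamgap
    omega
  -- Step 6: Harder ⇒ Eisenstein eigensystem; with Scholze's identity for `ρ|Γ_{F'}` ⇒ contradiction
  obtain ⟨χ₁, χ₂, hEis⟩ :=
    h₃ F' p 𝔫 lam q x a h𝔫 hdom hx (hev.mono fun w hw => hw.1) ι himpure
  refine h₄ F' p (ρ.restrictField F') hirr' χ₁ χ₂ ?_
  filter_upwards [hev, hEis] with w hw hwE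
  intro 𝔓 h𝔓 σ hσ
  rw [hw.2 𝔓 h𝔓 σ hσ, hwE 𝔓 h𝔓 σ hσ]

/-- By-name sanity check: the four stubs feed the composition as they stand. -/
example : LocallyReducibleParallel :=
  LocallyReducibleParallel_of stub_potCoh_bigImage stub_potCoh_residuallyDegenerate
    stub_harderEisenstein stub_notSumOfCharacters

end Summit.Langlands.Langlands.Cruxes.LocallyReducibleParallel.Eiscoh

end
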